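import Summits.QuantumFields.YangMills.Theorems.UnitScaleTiltProp7HcoWOfSigmaRowsDiv
import Summits.QuantumFields.YangMills.Theorems.UnitScaleTiltProp7HcoSOfGaugedRows
import HarnessLib

/-!
# Route `UnitScaleTilt`, crux K1 «MinimiserStabilityRegPr» (stmt-QuantumFields-19200) — ARCHITECTURE (A′) AFTER LOCATE v3 «GAUGE HOLE»: THE Σ-ROWS KNIT DOOR FOR THE NEW GROWTH SOCKET
# `hcoS` ((141)–(142) on Σ-representatives): `hcoS` ⇐ {COERC (slots), LANDAU, NORM, SLOT, QSMALL, `κ`-arithmetic, JOINT in P-A2’s currency + P-A4’s crude slice row, windows}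

Cell `ym3-torus` ∕ fleet seat `ym-ust-19200-p1` (gen 17, route-R E′ lead ∕ namer).  THEOREMS ONLY (0 `def`, 0 `sorry`); `--supports stmt-QuantumFields-19200`, count-neutral.
YM₃ on T³ is a ladder rung (R3), not the Clay problem; nothing here claims the stub, the crux, `hcoW`, `hcoS`, HESS, d = 4 or the mass gap — every row is DISPLAYED.

WHY.  ✓`Prop7HcoWOfHcoSigma.hcoW_of_hcoSigma` moved the growth socket to Σ-letters (binder `In19 ∕ AvgCondPrint ∕ IsLandauPrint`, no gauge transformation), where the rows of the
(A′) plan are inhabitable: on Σ the coarse gauge of the JOINT row is the explicit frame functional (✓P-A1 LEG), the averaging penalty with print’s twisted `Q` is second order, and no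
gauge-heavy data exist.  This file is ✓`hcoW_of_sigmaRowsW_slots_div` (p689738) RE-BASED on that binder, composed with ✓`Prop7HcoSOfGaugedRows.hcoS_of_gaugedRowsS` instead of
✓`hcoW_of_gaugedRowsW`: generic gauge-projector `Rr` and averaging `Qc` slots over lit `B11Eq103H1Complex.laplaceAK` (the intended inhabitant of `Qc` is the TWISTED averaging, (c1)),
HESS by ✓`Prop7HessOnPrintSlice.coercive_on_landau_of_coercive` + ✓`hess_arith`, JOINT knit by ✓`joint_arith`.

WHAT IS PROVED (ns `…Theorems.Prop7HcoSOfSigmaRows`): ★★★ `hcoS_of_sigmaRowsS` — rows VERBATIM as in p689738 with `ηA ↦ X`; CONCLUSION = `hcoS` VERBATIM.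
HONEST SCOPE.  Composition + real arithmetic over landed theorems; every analytic row is DISPLAYED; nothing of print is asserted.

References: T. Bałaban, CMP 102 (1985) 277–309 [Balaban1985Variational] ((19)–(21) p.281, (47) p.286, (106)–(111) p.294, (138)–(143) pp.298–299); CMP 99 (1985) 389–434
[Balaban1985BackgroundPropagators] ((3.10)–(3.12) p.392, Thm 3.11 p.416); CMP 99 (1985) 75–102 [Balaban1985RegularSpaces] ((1.38) p.82, Thm 2 p.83).
-/

set_option autoImplicit false
noncomputable section

open scoped BigOperators Matrix.Norms.L2Operator Matrix Topology InnerProductSpace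
open Filter NormedSpace

namespace Summit.QuantumFields.YangMills.Theorems.Prop7HcoSOfSigmaRows

open Literature.MathematicalPhysics.QuantumFieldTheory.Balaban1983to89
open Literature.MathematicalPhysics.QuantumFieldTheory.Balaban1983to89.T3ContinuumYM3Torus
open Literature.MathematicalPhysics.QuantumFieldTheory.Balaban1983to89.T3UnitLawDensityEML (ℰp)
open Literature.MathematicalPhysics.QuantumFieldTheory.Balaban1983to89.T3ConstrainedMinimiser (fibre)
open Literature.MathematicalPhysics.QuantumFieldTheory.Balaban1983to89.T3PrintedRegularMinimiser
open Literature.MathematicalPhysics.QuantumFieldTheory.Balaban1983to89.T3RegularMinimiser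
open Literature.MathematicalPhysics.QuantumFieldTheory.Balaban1983to89.T3Thm1Carrier
open T4Continuum BlockAveraging AveragingRT ExpMeanLog BlockAveragingEMLLinearised BlockAveragingEMLLinearisedBackground BlockAveragingEMLProp2
open B10Eq27TorusAxialLog (pull)
open T3SectALandauChart (emb15 eta bgUnits)
open B11Eq103H1Complex (BondL2K)
open Summit.QuantumFields.YangMills.Theorems.Prop7SPrint (basePt RestrictedPrint IsLandauPrintS)
open Summit.QuantumFields.YangMills.Theorems.Prop7SectET3Transport (periodsT3)
open Summit.QuantumFields.YangMills.Theorems.Prop7SectET3HilbertLetters (W₂ toL2)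
open Summit.QuantumFields.YangMills.Theorems.Prop7SectET3CurvedPropagators (Qk laplaceA)
open Summit.QuantumFields.YangMills.Theorems.Prop7HcoWOfGaugedRows (hcoW_of_gaugedRowsW)
open Summit.QuantumFields.YangMills.Theorems.Prop7HessOnPrintSlice (hess_of_laplaceA_coercive_of_isLandauPrintS)
open Summit.QuantumFields.YangMills.Theorems.Prop7HcoWOfSigmaRows (hess_arith)
open Summit.QuantumFields.YangMills.Theorems.Prop7SPrint (AvgCondPrint IsLandauPrint)
open Summit.QuantumFields.YangMills.Theorems.Prop7TPrint (expHermField)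
open T3SectALandauChart (In19)

/-! ## The door -/

section DoorSlots

variable (c₀ : ℕ → ℝ) [hc₀ : ∀ L : ℕ, Fact (0 < c₀ L)] (aQ : T3Family → ℕ → ℕ → ℝ)
  (Δx : ∀ (F : T3Family) (K : ℕ), GaugeField (F.P K) 0 (Matrix.specialUnitaryGroup (Fin 2) ℂ) → (BondL2K ℂ 3 (periodsT3 F K) (c₀ F.L) W₂ →ₗ[ℂ] BondL2K ℂ 3 (periodsT3 F K) (c₀ F.L) W₂))
  (Rr : ∀ (F : T3Family) (n K : ℕ), GaugeField (F.P K) 0 (Matrix.specialUnitaryGroup (Fin 2) ℂ) → (B11Eq103H1Complex.SiteL2K ℂ 3 (periodsT3 F K) (c₀ F.L) W₂ →ₗ[ℂ] B11Eq103H1Complex.SiteL2K ℂ 3 (periodsT3 F K) (c₀ F.L) W₂))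
  {CW : ∀ (F : T3Family) (n K : ℕ), n ≤ K → Type} [hCW₁ : ∀ F n K (h : n ≤ K), NormedAddCommGroup (CW F n K h)] [hCW₂ : ∀ F n K (h : n ≤ K), InnerProductSpace ℂ (CW F n K h)]
  [hCW₃ : ∀ F n K (h : n ≤ K), FiniteDimensional ℂ (CW F n K h)]
  (Qc : ∀ (F : T3Family) (n K : ℕ) (h : n ≤ K), GaugeField (F.P K) 0 (Matrix.specialUnitaryGroup (Fin 2) ℂ) → (BondL2K ℂ 3 (periodsT3 F K) (c₀ F.L) W₂ →ₗ[ℂ] CW F n K h))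

set_option maxHeartbeats 400000 in
/-- ★★★ **`hcoS` ⇐ THE Σ-ROWS (slots; JOINT in P-A2’s currency + P-A4’s crude slice row)** — ✓`hcoW_of_sigmaRowsW_slots_div` with the binder of `hcoS` (Σ-representatives `X`:
`In19`, `AvgCondPrint`, `IsLandauPrint`; `ηA ↦ X`) and conclusion `hcoS` VERBATIM; proof through ✓`hcoS_of_gaugedRowsS`.
[cite: Balaban1985Variational, (141)-(142) p.299, (19)-(21) p.281, (47) p.286, (106)-(111) p.294; Balaban1985BackgroundPropagators, Thm 3.11 p.416, (3.10)-(3.12) p.392; Balaban1985RegularSpaces, (1.38) p.82] -/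
theorem hcoS_of_sigmaRowsS
    (hSig : ∀ (L : ℕ), 1 < L → ∀ (B₁' : ℝ), 0 < B₁' → ∃ e₇ : ℝ, 0 < e₇ ∧
      ∀ (F : T3Family), F.L = L → ∀ (n K : ℕ) (hnK : n < K) (e : ℝ) (V : GaugeField (F.P n) 0 (Matrix.specialUnitaryGroup (Fin 2) ℂ))
        (W : GaugeField (F.P K) 0 (Matrix.specialUnitaryGroup (Fin 2) ℂ)) (X : PBond (F.P K) 0 → Matrix (Fin 2) (Fin 2) ℂ),
        0 < e → e ≤ e₇ → W ∈ regFibrePr F n K hnK.le e V →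
        (∀ γ : ℝ → GaugeField (F.P K) 0 (Matrix.specialUnitaryGroup (Fin 2) ℂ), γ 0 = W → (∀ t, γ t ∈ fibre F ℰp n K hnK.le V) →
          (∀ b, DifferentiableAt ℝ (fun t => ((γ t b : Matrix.specialUnitaryGroup (Fin 2) ℂ) : Matrix (Fin 2) (Fin 2) ℂ)) 0) →
            deriv (fun t => wilsonAction4 (γ t)) 0 = 0) →
        In19 F n K (2 * B₁' * e) W (expHermField X) X → AvgCondPrint F n K hnK.le V W X → IsLandauPrint F n K W X →
          ∃ s γ cN cK cE qK qM C₁ C₂ κ ζ δ₁ dv : ℝ, (∀ b : PBond (F.P K) 0, ‖X b‖ ≤ s) ∧ 4 * s ≤ 1 ∧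
            -- (COERC) the QUANTITATIVE coercivity of print's `Δ_a(W) = Δx(W) + D R_S D* + Q_k* a Q_k` on the member's weighted `L²` space ([B9] Thm 3.11 class; N06, RULING g28-№13 (c1)–(c4))
            (∀ y : BondL2K ℂ 3 (periodsT3 F K) (c₀ F.L) W₂, γ * ‖y‖ ^ 2 ≤ RCLike.re ⟪y, B11Eq103H1Complex.laplaceAK (Δx F K W) (Prop7SectET3HilbertLetters.DL2 F n K (c₀ F.L) W) (Rr F n K W) (Prop7SectET3HilbertLetters.DstarL2 F n K (c₀ F.L) W) (Qc F n K hnK.le W) (LinearMap.adjoint (Qc F n K hnK.le W)) (((aQ F n K : ℝ) : ℂ)) y⟫_ℂ) ∧ 0 ≤ γ ∧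
            -- (LANDAU-S) the representative sits on print's slice, read with the symmetric-tube projector `R_S` (the S twin of the hypothesis `IsLandau138`)
            Rr F n K W (Prop7SectET3HilbertLetters.DstarL2 F n K (c₀ F.L) W (toL2 F K (c₀ F.L) X)) = 0 ∧
            -- (NORM) the weighted `L²` norm dominates the chart mass
            cN * (∑ b : PBond (F.P K) 0, ‖X b‖ ^ 2) ≤ ‖toL2 F K (c₀ F.L) X‖ ^ 2 ∧
            -- (SLOT) the Hessian letter is bounded above by the curl form plus an `O(e)` mass term ((3.10): `Δ = D*D + Δ′`)
            RCLike.re ⟪toL2 F K (c₀ F.L) X, (Δx F K) W (toL2 F K (c₀ F.L) X)⟫_ℂ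
              ≤ cK * (∑ p : Plaq (F.P K) 0, ‖((Complex.I • X ⟨p.src, p.μ⟩) + ((W ⟨p.src, p.μ⟩ : Matrix (Fin 2) (Fin 2) ℂ) * (Complex.I • X ⟨p.src.shift p.μ, p.ν⟩) * star (W ⟨p.src, p.μ⟩ : Matrix (Fin 2) (Fin 2) ℂ))
            - (((W ⟨p.src, p.μ⟩ * W ⟨p.src.shift p.μ, p.ν⟩ * (W ⟨p.src.shift p.ν, p.μ⟩)⁻¹ : Matrix.specialUnitaryGroup (Fin 2) ℂ) : Matrix (Fin 2) (Fin 2) ℂ) * (Complex.I • X ⟨p.src.shift p.ν, p.μ⟩) * star ((W ⟨p.src, p.μ⟩ * W ⟨p.src.shift p.μ, p.ν⟩ * (W ⟨p.src.shift p.ν, p.μ⟩)⁻¹ : Matrix.specialUnitaryGroup (Fin 2) ℂ) : Matrix (Fin 2) (Fin 2) ℂ))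
            - (((GaugeField.plaqHol W p : Matrix.specialUnitaryGroup (Fin 2) ℂ) : Matrix (Fin 2) (Fin 2) ℂ) * (Complex.I • X ⟨p.src, p.ν⟩) * star ((GaugeField.plaqHol W p : Matrix.specialUnitaryGroup (Fin 2) ℂ) : Matrix (Fin 2) (Fin 2) ℂ)))‖ ^ 2)
                + cE * e * (((F.L : ℝ) ^ (K - n)) ^ 2)⁻¹ * (∑ b : PBond (F.P K) 0, ‖X b‖ ^ 2) ∧
            -- (QSMALL) the averaging penalty at the representative is small (on Σ it is fourth order)
            aQ F n K * ‖Qc F n K hnK.le W (toL2 F K (c₀ F.L) X)‖ ^ 2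
              ≤ qK * (∑ p : Plaq (F.P K) 0, ‖((Complex.I • X ⟨p.src, p.μ⟩) + ((W ⟨p.src, p.μ⟩ : Matrix (Fin 2) (Fin 2) ℂ) * (Complex.I • X ⟨p.src.shift p.μ, p.ν⟩) * star (W ⟨p.src, p.μ⟩ : Matrix (Fin 2) (Fin 2) ℂ))
            - (((W ⟨p.src, p.μ⟩ * W ⟨p.src.shift p.μ, p.ν⟩ * (W ⟨p.src.shift p.ν, p.μ⟩)⁻¹ : Matrix.specialUnitaryGroup (Fin 2) ℂ) : Matrix (Fin 2) (Fin 2) ℂ) * (Complex.I • X ⟨p.src.shift p.ν, p.μ⟩) * star ((W ⟨p.src, p.μ⟩ * W ⟨p.src.shift p.μ, p.ν⟩ * (W ⟨p.src.shift p.ν, p.μ⟩)⁻¹ : Matrix.specialUnitaryGroup (Fin 2) ℂ) : Matrix (Fin 2) (Fin 2) ℂ))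
            - (((GaugeField.plaqHol W p : Matrix.specialUnitaryGroup (Fin 2) ℂ) : Matrix (Fin 2) (Fin 2) ℂ) * (Complex.I • X ⟨p.src, p.ν⟩) * star ((GaugeField.plaqHol W p : Matrix.specialUnitaryGroup (Fin 2) ℂ) : Matrix (Fin 2) (Fin 2) ℂ)))‖ ^ 2)
                + qM * (((F.L : ℝ) ^ (K - n)) ^ 2)⁻¹ * (∑ b : PBond (F.P K) 0, ‖X b‖ ^ 2) ∧
            -- the HESS constant `κ` these rows deliver
            0 < cK + qK ∧ κ * (cK + qK) ≤ γ * cN - (cE * e + qM) * (((F.L : ℝ) ^ (K - n)) ^ 2)⁻¹ ∧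
            (∀ (Q : (k : ℕ) → (PBond (F.P K) 0 → Matrix (Fin 2) (Fin 2) ℂ) → PBond (F.P K) k → Matrix (Fin 2) (Fin 2) ℂ), (∀ Y, Q 0 Y = Y) →
        (∀ (k : ℕ) (Y : PBond (F.P K) 0 → Matrix (Fin 2) (Fin 2) ℂ) (c : PBond (F.P K) (k + 1)), Q (k + 1) Y c
          = fderiv ℂ (eml : (Idx (F.P K) → Matrix (Fin 2) (Fin 2) ℂ) → Matrix (Fin 2) (Fin 2) ℂ)
              (fun i => ((loopHol (Averaging.iter (fun i => blockAvg (P := F.P K) (j := i) (expMeanLogSU (n := Fin 2))) k W) c i :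
                Matrix.specialUnitaryGroup (Fin 2) ℂ) : Matrix (Fin 2) (Fin 2) ℂ))
              (fun i => covWalkSum (Averaging.iter (fun i => blockAvg (P := F.P K) (j := i) (expMeanLogSU (n := Fin 2))) k W) (Q k Y)
                  (walk (emb c.src) (loopWord (F.P K).L c.dir (off i.1) i.2.1 i.2.2))
                * ((loopHol (Averaging.iter (fun i => blockAvg (P := F.P K) (j := i) (expMeanLogSU (n := Fin 2))) k W) c i :
                  Matrix.specialUnitaryGroup (Fin 2) ℂ) : Matrix (Fin 2) (Fin 2) ℂ))
              * star ((corr (expMeanLogSU (n := Fin 2)) (Averaging.iter (fun i => blockAvg (P := F.P K) (j := i) (expMeanLogSU (n := Fin 2))) k W) c :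
                  Matrix.specialUnitaryGroup (Fin 2) ℂ) : Matrix (Fin 2) (Fin 2) ℂ)
            + ((corr (expMeanLogSU (n := Fin 2)) (Averaging.iter (fun i => blockAvg (P := F.P K) (j := i) (expMeanLogSU (n := Fin 2))) k W) c :
                  Matrix.specialUnitaryGroup (Fin 2) ℂ) : Matrix (Fin 2) (Fin 2) ℂ)
              * covWalkSum (Averaging.iter (fun i => blockAvg (P := F.P K) (j := i) (expMeanLogSU (n := Fin 2))) k W) (Q k Y)
                  (walk (emb c.src) (List.replicate (F.P K).L (c.dir, true)))
              * star ((corr (expMeanLogSU (n := Fin 2)) (Averaging.iter (fun i => blockAvg (P := F.P K) (j := i) (expMeanLogSU (n := Fin 2))) k W) c :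
                  Matrix.specialUnitaryGroup (Fin 2) ℂ) : Matrix (Fin 2) (Fin 2) ℂ)) →
            ∃ μ : Site (F.P K) (K - n) → Matrix (Fin 2) (Fin 2) ℂ, (∀ y, μ y ∈ skewAdjoint (Matrix (Fin 2) (Fin 2) ℂ) ∧ (μ y).trace = 0) ∧
            ∑ c : PBond (F.P K) (K - n), ‖Q (K - n) (fun b => Complex.I • X b) c
                - (μ c.src
                  - ((Averaging.iter (fun i => blockAvg (P := F.P K) (j := i) (expMeanLogSU (n := Fin 2))) (K - n) W c : Matrix.specialUnitaryGroup (Fin 2) ℂ) :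
                      Matrix (Fin 2) (Fin 2) ℂ) * μ c.tgt
                    * star ((Averaging.iter (fun i => blockAvg (P := F.P K) (j := i) (expMeanLogSU (n := Fin 2))) (K - n) W c : Matrix.specialUnitaryGroup (Fin 2) ℂ) :
                      Matrix (Fin 2) (Fin 2) ℂ))‖
              ≤ C₁ * ((F.L : ℝ) ^ (K - n))⁻¹ * (∑ b : PBond (F.P K) 0, ‖X b‖ ^ 2)
                + C₂ * (F.L : ℝ) ^ (K - n) * (∑ p : Plaq (F.P K) 0, ‖((Complex.I • X ⟨p.src, p.μ⟩) + ((W ⟨p.src, p.μ⟩ : Matrix (Fin 2) (Fin 2) ℂ) * (Complex.I • X ⟨p.src.shift p.μ, p.ν⟩) * star (W ⟨p.src, p.μ⟩ : Matrix (Fin 2) (Fin 2) ℂ))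
            - (((W ⟨p.src, p.μ⟩ * W ⟨p.src.shift p.μ, p.ν⟩ * (W ⟨p.src.shift p.ν, p.μ⟩)⁻¹ : Matrix.specialUnitaryGroup (Fin 2) ℂ) : Matrix (Fin 2) (Fin 2) ℂ) * (Complex.I • X ⟨p.src.shift p.ν, p.μ⟩) * star ((W ⟨p.src, p.μ⟩ * W ⟨p.src.shift p.μ, p.ν⟩ * (W ⟨p.src.shift p.ν, p.μ⟩)⁻¹ : Matrix.specialUnitaryGroup (Fin 2) ℂ) : Matrix (Fin 2) (Fin 2) ℂ))
            - (((GaugeField.plaqHol W p : Matrix.specialUnitaryGroup (Fin 2) ℂ) : Matrix (Fin 2) (Fin 2) ℂ) * (Complex.I • X ⟨p.src, p.ν⟩) * star ((GaugeField.plaqHol W p : Matrix.specialUnitaryGroup (Fin 2) ℂ) : Matrix (Fin 2) (Fin 2) ℂ)))‖ ^ 2 + dv)) ∧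
            -- (DIV-SLICE) P-A4: on print’s slice the member’s covariant-divergence mass `dv` is booked against the curl form and an `ℓ⁻²`-mass term (crude slice row; [B10] (1.38))
            0 ≤ C₂ ∧ dv ≤ ζ * ∑ p : Plaq (F.P K) 0, ‖((Complex.I • X ⟨p.src, p.μ⟩) + ((W ⟨p.src, p.μ⟩ : Matrix (Fin 2) (Fin 2) ℂ) * (Complex.I • X ⟨p.src.shift p.μ, p.ν⟩) * star (W ⟨p.src, p.μ⟩ : Matrix (Fin 2) (Fin 2) ℂ))
            - (((W ⟨p.src, p.μ⟩ * W ⟨p.src.shift p.μ, p.ν⟩ * (W ⟨p.src.shift p.ν, p.μ⟩)⁻¹ : Matrix.specialUnitaryGroup (Fin 2) ℂ) : Matrix (Fin 2) (Fin 2) ℂ) * (Complex.I • X ⟨p.src.shift p.ν, p.μ⟩) * star ((W ⟨p.src, p.μ⟩ * W ⟨p.src.shift p.μ, p.ν⟩ * (W ⟨p.src.shift p.ν, p.μ⟩)⁻¹ : Matrix.specialUnitaryGroup (Fin 2) ℂ) : Matrix (Fin 2) (Fin 2) ℂ))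
            - (((GaugeField.plaqHol W p : Matrix.specialUnitaryGroup (Fin 2) ℂ) : Matrix (Fin 2) (Fin 2) ℂ) * (Complex.I • X ⟨p.src, p.ν⟩) * star ((GaugeField.plaqHol W p : Matrix.specialUnitaryGroup (Fin 2) ℂ) : Matrix (Fin 2) (Fin 2) ℂ)))‖ ^ 2
                + δ₁ * (((F.L : ℝ) ^ (K - n)) ^ 2)⁻¹ * (∑ b : PBond (F.P K) 0, ‖X b‖ ^ 2) ∧
            2 * e * (C₂ * (1 + ζ)) ≤ 1 / 8 ∧
            2 * e * (C₁ + C₂ * δ₁) * (((F.L : ℝ) ^ (K - n)) ^ 2)⁻¹ + 15552 * s ^ 2 + 216 * regThreshold F n K e ≤ κ / 8) :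
    ∀ (L : ℕ), 1 < L → ∀ (B₁' : ℝ), 0 < B₁' → ∃ e₇ : ℝ, 0 < e₇ ∧
      ∀ (F : T3Family), F.L = L → ∀ (n K : ℕ) (hnK : n < K) (e : ℝ) (V : GaugeField (F.P n) 0 (Matrix.specialUnitaryGroup (Fin 2) ℂ))
        (W : GaugeField (F.P K) 0 (Matrix.specialUnitaryGroup (Fin 2) ℂ)) (X : PBond (F.P K) 0 → Matrix (Fin 2) (Fin 2) ℂ),
        0 < e → e ≤ e₇ → W ∈ regFibrePr F n K hnK.le e V →
        (∀ γ : ℝ → GaugeField (F.P K) 0 (Matrix.specialUnitaryGroup (Fin 2) ℂ), γ 0 = W → (∀ t, γ t ∈ fibre F ℰp n K hnK.le V) →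
          (∀ b, DifferentiableAt ℝ (fun t => ((γ t b : Matrix.specialUnitaryGroup (Fin 2) ℂ) : Matrix (Fin 2) (Fin 2) ℂ)) 0) →
            deriv (fun t => wilsonAction4 (γ t)) 0 = 0) →
        In19 F n K (2 * B₁' * e) W (expHermField X) X → AvgCondPrint F n K hnK.le V W X → IsLandauPrint F n K W X →
          wilsonAction4 W ≤ wilsonAction4 (emb15 W (expHermField X)) := by
  refine Prop7HcoSOfGaugedRows.hcoS_of_gaugedRowsS ?_
  intro L hL B₁' hB₁'
  obtain ⟨e₇, he₇, H⟩ := hSig L hL B₁' hB₁'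
  refine ⟨e₇, he₇, ?_⟩
  intro F hF n K hnK e V W X he heε hWreg hEL h19 h20 h21
  obtain ⟨s, γ, cN, cK, cE, qK, qM, C₁, C₂, κ, ζ, δ₁, dv, hs, hs4, hco, hγ, hLS, hN, hSl, hQ, hpos, hκ, hJ, hC₂, hdv, hw1, hw2⟩ :=
    H F hF n K hnK e V W X he heε hWreg hEL h19 h20 h21
  refine ⟨s, κ, C₁ + C₂ * δ₁, C₂ * (1 + ζ), hs, hs4, ?_, ?_, hw1, hw2⟩
  · -- HESS `κ·M ≤ K` from the Σ-rows: the gauge penalty of `Δ_a` vanishes on print's slice (✓p686677), then arithmetic (✓`hess_arith`)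
    have h1 : γ * ‖toL2 F K (c₀ F.L) X‖ ^ 2 - aQ F n K * ‖Qc F n K hnK.le W (toL2 F K (c₀ F.L) X)‖ ^ 2
        ≤ RCLike.re ⟪toL2 F K (c₀ F.L) X, (Δx F K) W (toL2 F K (c₀ F.L) X)⟫_ℂ := by
      have h0 := Prop7HessOnPrintSlice.coercive_on_landau_of_coercive (Δx F K W) (Prop7SectET3HilbertLetters.DL2 F n K (c₀ F.L) W) (Rr F n K W)
        (Prop7SectET3HilbertLetters.DstarL2 F n K (c₀ F.L) W) (Qc F n K hnK.le W) (LinearMap.adjoint (Qc F n K hnK.le W)) (((aQ F n K : ℝ) : ℂ)) rfl hco hLS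
      have ha : RCLike.re (((aQ F n K : ℝ) : ℂ)) = aQ F n K := by simp [RCLike.re_to_complex]
      rw [ha] at h0
      exact h0
    have hM : (0 : ℝ) ≤ ∑ b : PBond (F.P K) 0, ‖X b‖ ^ 2 := Finset.sum_nonneg fun b _ => by positivity
    exact hess_arith hM hγ h1 hN hSl hQ hpos hκ
  · -- JOINT in the door's currency from the binder currency `C₁ℓ⁻¹M + C₂ℓ(K + dv)` and the crude slice row (✓`joint_arith`)
    intro Q hQ0 hQs
    obtain ⟨μ, hμ, hb⟩ := hJ Q hQ0 hQs
    refine ⟨μ, hμ, hb.trans ?_⟩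
    have hLpos : (0 : ℝ) < (F.L : ℝ) ^ (K - n) := by
      have : (1 : ℝ) < (F.L : ℝ) := by rw [hF]; exact_mod_cast hL
      positivity
    exact Prop7HcoWOfSigmaRowsDiv.joint_arith hLpos hC₂ hdv

end DoorSlots

end Summit.QuantumFields.YangMills.Theorems.Prop7HcoSOfSigmaRows

end
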